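import Summits.Ventures.Crystal3D.Theorems.StickyWulffConstantCoaxialWallLawEndRowRatNarrow
import HarnessLib

/-!
# Kernel certificate `endRowTrans_v2_ge`: `EndRowTrans WordVersion.v2 s_F → 439/90 ≤ s_F`

HONEST FRAMING. Venture `Summits/Ventures/Crystal3D` (cell `crystal3d-full`), helper `--supports` the crux `CoaxialWallLaw`
(stmt-Ventures-19481, `route-Ventures-StickyWulffConstant`, REGISTERED line `WallLedgerF`, open stub `stub_coaxialTwoSlabAdhesion`).
Seat 19481-p1 gen 12 (adversarial census ADV-ROW, memo HOME/wall-19481-p1/g12/F-ADVROW-g12.md).  A LOWER BOUND on any constant of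
the census Prop `EndRowTrans WordVersion.v2` (`…CoaxialWallLawEndRowDefs`), by an explicit finite configuration evaluated in the integer /
rational frame model of `…EndRowIntModel`, `…EndRowIntReadings`, `…EndRowRatFrames`, `…EndRowRatMoves`, `…EndRowRatNarrow`
(straight moves from FULL / GLIDING / NARROW predecessors at depth 0 and depth 1, CROSS moves).  Witness (cubic `√18`-integer
coordinates after normalising the reading frame to the base frame `L`): `166` sites, payer `zC`, `8` end balls, `30` exhibited
end pairs; exhibited value `439/90 = 4.877778` (`2√6 = 4.898979…`).  COMPUTATIONAL GRADE: one `native_decide` (`factsC`).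
WHAT THIS IS NOT: no claim about the physical wall law or the crux; F-C1 not moved.
-/

noncomputable section

namespace Summit.Ventures.Crystal3D.Theorems

open Summit.Ventures.Crystal3D Finset NearIdentity
open Literature.MathematicalPhysics.StatisticalMechanics (barlowPos fccStacking constHagg)
open scoped InnerProductSpace

namespace EndRowFloor

namespace CertV2a

/-- Integer triples as model vectors. -/
def toV (p : ℤ × ℤ × ℤ) : Fin 3 → ℤ := ![p.1, p.2.1, p.2.2]

set_option maxHeartbeats 2000000 in
/-- The raw site list of the witness. -/
def rawC : List (ℤ × ℤ × ℤ) :=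
  [(-7, -2, -1), (-7, 1, -4), (-7, 1, 2), (-7, 4, -7), (-7, 4, -1), (-7, 4, 5), (-7, 7, -4), (-7, 7, 2), (-7, 10, -1), (-6, -6, 0), (-6, -3, 3), (-6, 0, 6), (-6, 3, 9), (-4, -5, -7), (-4, -2, -4), (-4, 1, -7), (-4, 1, -1), (-4, 4, -10), (-4, 4, -4), (-4, 4, 2), (-4, 7, -7), (-4, 7, -1), (-4, 7, 5), (-4, 10, -4), (-4, 10, 2), (-4, 10, 8), (-4, 13, -1), (-3, -6, -3), (-3, -6, 3), (-3, -3, 0), (-3, -3, 6), (-3, 0, 3), (-3, 0, 9), (-3, 3, 6), (-3, 6, 9), (-1, -2, -7), (-1, 1, -10), (-1, 1, -4), (-1, 4, -7), (-1, 4, -1), (-1, 7, -10), (-1, 7, -4), (-1, 7, 2), (-1, 10, -7), (-1, 10, -1), (-1, 10, 5), (-1, 13, -4), (-1, 13, 2), (0, -9, -3), (0, -9, 3), (0, -6, -6), (0, -6, 0), (0, -6, 6), (0, -3, -3), (0, -3, 3), (0, -3, 9), (0, 0, 0), (0, 0, 6), (0, 0, 12), (0, 3, 3), (0, 3, 9),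 (0, 6, 6), (0, 6, 12), (0, 9, 9), (2, -2, -10), (2, 1, -7), (2, 4, -10), (2, 4, -4), (2, 7, -7), (2, 7, -1), (2, 10, -10), (2, 10, -4), (2, 10, 2), (2, 13, -7), (2, 13, -1), (2, 13, 5), (3, -9, 0), (3, -6, -9), (3, -6, -3), (3, -6, 3), (3, -6, 9), (3, -3, -6), (3, -3, 0), (3, -3, 6), (3, 0, -3), (3, 0, 9), (3, 3, 0), (3, 3, 6), (3, 3, 12), (3, 6, 3), (3, 6, 9), (3, 9, 6), (3, 12, 9), (5, 1, -10), (5, 4, -7), (5, 7, -10), (5, 10, -7), (5, 10, -1), (5, 13, -4), (5, 13, 2), (6, -9, -3), (6, -9, 3), (6, -6, -6), (6, -6, 0), (6, -6, 6), (6, -3, -9), (6, -3, -3), (6, -3, 3), (6, -3, 9), (6, 0, -6), (6, 0, 0), (6, 0, 6), (6, 0, 12), (6, 3, -3), (6, 3, 3), (6, 3, 9), (6, 6, 0), (6, 6, 6), (6, 6, 12), (6, 9, 3), (6, 9, 9), (6, 12, 6), (8, 4, -10), (8, 7, -7), (8, 10, -4), (8, 13, -1), (9, -6, -3), (9, -6,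 3), (9, -3, -6), (9, -3, 0), (9, -3, 6), (9, 0, -9), (9, 0, -3), (9, 0, 3), (9, 0, 9), (9, 3, -6), (9, 3, 0), (9, 3, 6), (9, 6, -3), (9, 6, 3), (9, 6, 9), (9, 9, 0), (9, 9, 6), (9, 12, 3), (11, 10, -7), (12, -6, 0), (12, -3, -3), (12, -3, 3), (12, 0, -6), (12, 0, 0), (12, 0, 6), (12, 3, -9), (12, 3, -3), (12, 3, 3), (12, 3, 9), (12, 6, -6), (12, 6, 0), (12, 6, 6), (12, 9, -3), (12, 9, 3), (12, 12, 0), (15, 0, -3), (15, 0, 3), (15, 3, 0), (15, 6, -3), (15, 6, 3)]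

/-- The site set of the witness. -/
def SC : Finset (Fin 3 → ℤ) := (rawC.map toV).toFinset

/-- The payer. -/
def zC : Fin 3 → ℤ := ![3, 3, 0]

/-- The end balls pooled at the payer. -/
def bC : Fin 8 → (Fin 3 → ℤ) := ![![3, 3, 0], ![2, 4, -4], ![0, 0, 0], ![0, 3, 3], ![6, 3, -3], ![2, 7, -1], ![6, 6, 0], ![6, 3, 3]]

/-- The exhibited end pairs `(end ball, kind, direction slot, crossing/normal index, letter, predecessor)`; kinds:
`0/1/2` = straight FULL / GLIDE / NARROW predecessor at depth 0 (`τ = 1`), `3/4/5` = the same at depth 1 (frame reflected across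
the letter `cubeInt c₀`, `τ = −1`), `6` = CROSS of a depth-0 class, `7` = CROSS of a depth-1 class. -/
def prsC : List (Fin 8 × Fin 8 × Fin 12 × Fin 8 × Fin 8 × (Fin 3 → ℤ)) :=
  [(0, 2, 3, 6, 0, ![6, 6, 0]),
   (0, 5, 4, 5, 2, ![2, 7, -1]),
   (0, 2, 7, 5, 0, ![6, 3, 3]),
   (0, 5, 10, 1, 2, ![-1, 4, -1]),
   (1, 1, 0, 2, 0, ![-1, 1, -4]),
   (1, 0, 4, 0, 0, ![-1, 4, -7]),
   (1, 5, 7, 0, 5, ![3, 0, -3]),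
   (1, 5, 9, 6, 5, ![6, 3, -3]),
   (1, 2, 10, 6, 0, ![2, 7, -7]),
   (2, 1, 0, 5, 0, ![-3, -3, 0]),
   (2, 5, 4, 5, 2, ![-1, 4, -1]),
   (2, 2, 9, 5, 0, ![0, -3, 3]),
   (2, 5, 10, 1, 2, ![-4, 1, -1]),
   (3, 5, 4, 5, 2, ![-1, 7, 2]),
   (3, 2, 7, 5, 0, ![3, 3, 6]),
   (3, 2, 9, 5, 0, ![0, 0, 6]),
   (3, 5, 10, 1, 2, ![-4, 4, 2]),
   (4, 0, 7, 0, 0, ![9, 3, 0]),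
   (4, 2, 9, 1, 0, ![6, 0, 0]),
   (4, 5, 10, 5, 2, ![2, 4, -4]),
   (5, 1, 0, 2, 0, ![-1, 4, -1]),
   (5, 0, 4, 0, 0, ![-1, 7, -4]),
   (5, 5, 7, 0, 5, ![3, 3, 0]),
   (5, 5, 9, 6, 5, ![6, 6, 0]),
   (5, 2, 10, 6, 0, ![2, 10, -4]),
   (6, 5, 4, 5, 2, ![5, 10, -1]),
   (6, 0, 7, 0, 0, ![9, 6, 3]),
   (6, 2, 9, 1, 0, ![6, 3, 3]),
   (6, 5, 10, 5, 2, ![2, 7, -1]),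
   (7, 0, 3, 0, 0, ![9, 6, 3])]

/-- The exhibited predecessors of the end ball `j`. -/
def QsC (j : Fin 8) : Finset (Fin 3 → ℤ) := ((prsC.filter fun e => e.1 = j).map fun e => e.2.2.2.2.2).toFinset

/-- Slot / menu tables of the frames involved. -/
def g1 (c : Fin 8) : Fin 12 → (Fin 3 → ℚ) := gR (wBase c) gBase
/-- See `g1`. -/
def w1 (c : Fin 8) : Fin 8 → (Fin 3 → ℚ) := wR (wBase c) wBase
/-- See `g1`. -/
def g2 (c₀ c : Fin 8) : Fin 12 → (Fin 3 → ℚ) := gR (w1 c₀ c) (g1 c₀)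
/-- See `g1`. -/
def w2 (c₀ c : Fin 8) : Fin 8 → (Fin 3 → ℚ) := wR (w1 c₀ c) (w1 c₀)

/-- End-ball tests in a frame with tables `(g, w)` for direction `(i, τ)`. -/
def endOK (g : Fin 12 → (Fin 3 → ℚ)) (w : Fin 8 → (Fin 3 → ℚ)) (b : Fin 3 → ℤ) (i : Fin 12) (τ : ℤ) : Prop :=
  fullQ g (SQ SC) (castQ b) = false ∧ (∀ c' : Fin 8, twinFailQ g w (SQ SC) (castQ b) c' = true) ∧
    narrowFailQ g (SQ SC) (castQ b) i τ = true

/-- Kind 0: straight from a FULL predecessor at depth 0. -/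
def K0 (j : Fin 8) (i : Fin 12) (q : Fin 3 → ℤ) : Prop :=
  castQ (bC j) = castQ q + (1 : ℚ) • gBase i ∧ fullQ gBase (SQ SC) (castQ q) = true ∧ endOK gBase wBase (bC j) i 1
/-- Kind 1: straight from a GLIDING predecessor at depth 0. -/
def K1 (j : Fin 8) (i : Fin 12) (c : Fin 8) (q : Fin 3 → ℤ) : Prop :=
  castQ (bC j) = castQ q + (1 : ℚ) • gBase i ∧ twinOKQ gBase wBase (SQ SC) (castQ q) c = true ∧
    dz (slotInt i) (cubeInt c) = 0 ∧ endOK gBase wBase (bC j) i 1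
/-- Kind 2: straight from a NARROW predecessor at depth 0. -/
def K2 (j : Fin 8) (i : Fin 12) (c : Fin 8) (q : Fin 3 → ℤ) : Prop :=
  castQ (bC j) = castQ q + (1 : ℚ) • gBase i ∧ narrowOKQ gBase (SQ SC) (castQ q) i 1 c = true ∧ endOK gBase wBase (bC j) i 1
/-- Kind 3: straight from a FULL predecessor at depth 1. -/
def K3 (j : Fin 8) (i : Fin 12) (c₀ : Fin 8) (q : Fin 3 → ℤ) : Prop :=
  dz (slotInt i) (cubeInt c₀) = 2 ∧ castQ (bC j) = castQ q + ((-1 : ℤ) : ℚ) • g1 c₀ i ∧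
    fullQ (g1 c₀) (SQ SC) (castQ q) = true ∧ endOK (g1 c₀) (w1 c₀) (bC j) i (-1)
/-- Kind 4: straight from a GLIDING predecessor at depth 1. -/
def K4 (j : Fin 8) (i : Fin 12) (c c₀ : Fin 8) (q : Fin 3 → ℤ) : Prop :=
  dz (slotInt i) (cubeInt c₀) = 2 ∧ castQ (bC j) = castQ q + ((-1 : ℤ) : ℚ) • g1 c₀ i ∧
    twinOKQ (g1 c₀) (w1 c₀) (SQ SC) (castQ q) c = true ∧ dz (slotInt i) (cubeInt c) = 0 ∧ endOK (g1 c₀) (w1 c₀) (bC j) i (-1)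
/-- Kind 5: straight from a NARROW predecessor at depth 1. -/
def K5 (j : Fin 8) (i : Fin 12) (c c₀ : Fin 8) (q : Fin 3 → ℤ) : Prop :=
  dz (slotInt i) (cubeInt c₀) = 2 ∧ castQ (bC j) = castQ q + ((-1 : ℤ) : ℚ) • g1 c₀ i ∧
    narrowOKQ (g1 c₀) (SQ SC) (castQ q) i (-1) c = true ∧ endOK (g1 c₀) (w1 c₀) (bC j) i (-1)
/-- Kind 6: CROSS of a depth-0 class. -/
def K6 (j : Fin 8) (i : Fin 12) (c : Fin 8) (q : Fin 3 → ℤ) : Prop :=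
  (1 : ℤ) * dz (slotInt i) (cubeInt c) = 2 ∧ castQ (bC j) = castQ q - ((1 : ℤ) : ℚ) • mirQ gBase wBase i c ∧
    twinOKQ gBase wBase (SQ SC) (castQ q) c = true ∧ endOK (g1 c) (w1 c) (bC j) i (-1)
/-- Kind 7: CROSS of a depth-1 class. -/
def K7 (j : Fin 8) (i : Fin 12) (c c₀ : Fin 8) (q : Fin 3 → ℤ) : Prop :=
  dz (slotInt i) (cubeInt c₀) = 2 ∧ (-1 : ℤ) * dz (slotInt i) (cubeInt c) = 2 ∧
    castQ (bC j) = castQ q - ((-1 : ℤ) : ℚ) • mirQ (g1 c₀) (w1 c₀) i c ∧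
    twinOKQ (g1 c₀) (w1 c₀) (SQ SC) (castQ q) c = true ∧ endOK (g2 c₀ c) (w2 c₀ c) (bC j) i (- -1)

/-- Decidability of the end-ball tests. -/
instance instDecEndOK (g : Fin 12 → (Fin 3 → ℚ)) (w : Fin 8 → (Fin 3 → ℚ)) (b : Fin 3 → ℤ) (i : Fin 12) (τ : ℤ) :
    Decidable (endOK g w b i τ) := by unfold endOK; infer_instance
/-- Decidability of the kind clauses. -/
instance instDecK0 (j i q) : Decidable (K0 j i q) := by unfold K0; infer_instance
/-- See `instDecK0`. -/
instance instDecK1 (j i c q) : Decidable (K1 j i c q) := by unfold K1; infer_instance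
/-- See `instDecK0`. -/
instance instDecK2 (j i c q) : Decidable (K2 j i c q) := by unfold K2; infer_instance
/-- See `instDecK0`. -/
instance instDecK3 (j i c₀ q) : Decidable (K3 j i c₀ q) := by unfold K3; infer_instance
/-- See `instDecK0`. -/
instance instDecK4 (j i c c₀ q) : Decidable (K4 j i c c₀ q) := by unfold K4; infer_instance
/-- See `instDecK0`. -/
instance instDecK5 (j i c c₀ q) : Decidable (K5 j i c c₀ q) := by unfold K5; infer_instance
/-- See `instDecK0`. -/
instance instDecK6 (j i c q) : Decidable (K6 j i c q) := by unfold K6; infer_instance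
/-- See `instDecK0`. -/
instance instDecK7 (j i c c₀ q) : Decidable (K7 j i c c₀ q) := by unfold K7; infer_instance

/-- The per-pair certificate (decidable). -/
def PairOK (e : Fin 8 × Fin 8 × Fin 12 × Fin 8 × Fin 8 × (Fin 3 → ℤ)) : Prop :=
  e.2.2.2.2.2 ∈ SC ∧ (slotKIJ e.2.2.1).1 = 0 ∧ (-24 * slotInt e.2.2.1 0 - 7 * slotInt e.2.2.1 2 : ℤ) ≠ 0 ∧
  (e.2.1 = 0 → K0 e.1 e.2.2.1 e.2.2.2.2.2) ∧ (e.2.1 = 1 → K1 e.1 e.2.2.1 e.2.2.2.1 e.2.2.2.2.2) ∧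
  (e.2.1 = 2 → K2 e.1 e.2.2.1 e.2.2.2.1 e.2.2.2.2.2) ∧ (e.2.1 = 3 → K3 e.1 e.2.2.1 e.2.2.2.2.1 e.2.2.2.2.2) ∧
  (e.2.1 = 4 → K4 e.1 e.2.2.1 e.2.2.2.1 e.2.2.2.2.1 e.2.2.2.2.2) ∧ (e.2.1 = 5 → K5 e.1 e.2.2.1 e.2.2.2.1 e.2.2.2.2.1 e.2.2.2.2.2) ∧
  (e.2.1 = 6 → K6 e.1 e.2.2.1 e.2.2.2.1 e.2.2.2.2.2) ∧ (e.2.1 = 7 → K7 e.1 e.2.2.1 e.2.2.2.1 e.2.2.2.2.1 e.2.2.2.2.2)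

/-- Decidability of the per-pair certificate. -/
instance instDecPairOK (e : Fin 8 × Fin 8 × Fin 12 × Fin 8 × Fin 8 × (Fin 3 → ℤ)) : Decidable (PairOK e) := by
  unfold PairOK; infer_instance

/-- **All finite facts of the certificate, by evaluation** (`native_decide`). -/
theorem factsC :
    (∀ u ∈ SC, ∀ v ∈ SC, u ≠ v → 18 ≤ dz (u - v) (u - v)) ∧ zC ∈ SC ∧ degS SC zC ≤ 11 ∧
    (∀ j j' : Fin 8, bC j = bC j' → j = j') ∧
    (∀ j : Fin 8, bC j ∈ SC ∧ degS SC (bC j) ≤ 11 ∧ dz (zC - bC j) (zC - bC j) ≤ 18 ∧ 0 < pooledS SC (bC j) ∧ 0 < (QsC j).card) ∧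
    (∀ e ∈ prsC, PairOK e) ∧
    (∑ j : Fin 8, ((QsC j).card : ℚ) / (pooledS SC (bC j) : ℚ)) = 439 / 90 := by
  native_decide


open scoped Classical in
/-- Exhibited end pairs bound the end multiplicity from below (any word version). -/
theorem le_endMult_v {ver : WordVersion} {S : Finset (Fin 3 → ℤ)} (b : Fin 3 → ℤ) (Q : Finset (Fin 3 → ℤ))
    (hQ : ∀ q ∈ Q, IsEndPair (Xof S) ver S1 S2 (P b) (P q)) : Q.card ≤ endMult (Xof S) ver S1 S2 (P b) := by
  unfold endMult
  rw [← Finset.card_map Pemb]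
  apply Finset.card_le_card
  intro x hx
  rw [Finset.mem_map] at hx
  obtain ⟨q, hq, rfl⟩ := hx
  rw [Finset.mem_filter]
  exact ⟨(hQ q hq).1, hQ q hq⟩

/-- Assembling an end pair (any word version). -/
theorem isEndPair_gen_v {ver : WordVersion} {S : Finset (Fin 3 → ℤ)} {b q : Fin 3 → ℤ} (hq : q ∈ S) (hb : b ∈ S)
    (hdeg : degS S b ≤ 11) (G : EuclideanSpace ℝ (Fin 3) ≃ₗᵢ[ℝ] EuclideanSpace ℝ (Fin 3)) (d : EuclideanSpace ℝ (Fin 3))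
    (hadm : S1.Adm G d ∨ S2.Adm G d) (hmove : IsEndMove (Xof S) ver G d (PQ (castQ q)) (PQ (castQ b))) :
    IsEndPair (Xof S) ver S1 S2 (P b) (P q) := by
  refine ⟨mem_Xof.2 hq, mem_Xof.2 hb, hasTwoPayers_of_deg hdeg, G, d, hadm, ?_⟩
  rw [P_eq_PQ, P_eq_PQ]; exact hmove

set_option maxRecDepth 8192 in
open scoped Classical in
/-- The exhibited end pairs are end pairs. -/
theorem card_QsC_le_endMult (j : Fin 8) : (QsC j).card ≤ endMult (Xof SC) WordVersion.v2 S1 S2 (P (bC j)) := by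
  have hF := factsC
  have hballs := hF.2.2.2.2.1
  have hpairs := hF.2.2.2.2.2.1
  have hbS : bC j ∈ SC := (hballs j).1
  have hbdeg : degS SC (bC j) ≤ 11 := (hballs j).2.1
  apply le_endMult_v
  intro q hq
  rw [QsC, List.mem_toFinset, List.mem_map] at hq
  obtain ⟨e, he, rfl⟩ := hq
  rw [List.mem_filter] at he
  obtain ⟨he, hej⟩ := he
  have hP := hpairs e he
  obtain ⟨j', k, i, c, c₀, q⟩ := e
  simp only [decide_eq_true_eq] at hej
  subst hej
  obtain ⟨hqS, hk, hN, h0, h1, h2, h3, h4, h5, h6, h7⟩ := hP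
  have eB : RatFrame.base.Φ = L := rfl
  have eR1 : ∀ c₀ : Fin 8, (RatFrame.base.reflect c₀).g = g1 c₀ := fun _ => rfl
  have eW1 : ∀ c₀ : Fin 8, (RatFrame.base.reflect c₀).w = w1 c₀ := fun _ => rfl
  fin_cases k
  · obtain ⟨hbq, hq', hb1, hb2, hb3⟩ := (h0 rfl : K0 _ _ _)
    refine isEndPair_gen_v hqS hbS hbdeg L (L (slotSite i)) (adm_root_or hk hN) ?_
    have h := RatFrame.base.isEndMove_full_any (S := SC) WordVersion.v2 (castQ q) (castQ (bC j')) i 1 hbq hq' hb1 hb2 hb3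
    rw [eB, Int.cast_one, one_smul] at h; exact h
  · obtain ⟨hbq, hq', hperp, hb1, hb2, hb3⟩ := (h1 rfl : K1 _ _ _ _)
    refine isEndPair_gen_v hqS hbS hbdeg L (L (slotSite i)) (adm_root_or hk hN) ?_
    have h := RatFrame.base.isEndMove_glide_any (S := SC) WordVersion.v2 (castQ q) (castQ (bC j')) i 1 c hbq hq' hperp hb1 hb2 hb3
    rw [eB, Int.cast_one, one_smul] at h; exact h
  · obtain ⟨hbq, hq', hb1, hb2, hb3⟩ := (h2 rfl : K2 _ _ _ _)
    refine isEndPair_gen_v hqS hbS hbdeg L (L (slotSite i)) (adm_root_or hk hN) ?_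
    have h := RatFrame.base.isEndMove_narrow (S := SC) (castQ q) (castQ (bC j')) i 1 c hbq hq' hb1 hb2 hb3
    rw [eB, Int.cast_one, one_smul] at h; exact h
  · obtain ⟨hup0, hbq, hq', hb1, hb2, hb3⟩ := (h3 rfl : K3 _ _ _ _)
    refine isEndPair_gen_v hqS hbS hbdeg (RatFrame.base.reflect c₀).Φ ((-1 : ℝ) • (RatFrame.base.reflect c₀).Φ (slotSite i))
      (adm_depth1_or hk hN c₀ hup0) ?_
    have h := (RatFrame.base.reflect c₀).isEndMove_full_any (S := SC) WordVersion.v2 (castQ q) (castQ (bC j')) i (-1) hbq hq' hb1 hb2 hb3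
    simpa using h
  · obtain ⟨hup0, hbq, hq', hperp, hb1, hb2, hb3⟩ := (h4 rfl : K4 _ _ _ _ _)
    refine isEndPair_gen_v hqS hbS hbdeg (RatFrame.base.reflect c₀).Φ ((-1 : ℝ) • (RatFrame.base.reflect c₀).Φ (slotSite i))
      (adm_depth1_or hk hN c₀ hup0) ?_
    have h := (RatFrame.base.reflect c₀).isEndMove_glide_any (S := SC) WordVersion.v2 (castQ q) (castQ (bC j')) i (-1) c hbq hq' hperp hb1 hb2 hb3
    simpa using h
  · obtain ⟨hup0, hbq, hq', hb1, hb2, hb3⟩ := (h5 rfl : K5 _ _ _ _ _)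
    refine isEndPair_gen_v hqS hbS hbdeg (RatFrame.base.reflect c₀).Φ ((-1 : ℝ) • (RatFrame.base.reflect c₀).Φ (slotSite i))
      (adm_depth1_or hk hN c₀ hup0) ?_
    have h := (RatFrame.base.reflect c₀).isEndMove_narrow (S := SC) (castQ q) (castQ (bC j')) i (-1) c hbq hq' hb1 hb2 hb3
    simpa using h
  · obtain ⟨hup, hbq, hq', hb1, hb2, hb3⟩ := (h6 rfl : K6 _ _ _ _)
    refine isEndPair_gen_v hqS hbS hbdeg L (L (slotSite i)) (adm_root_or hk hN) ?_
    have h := RatFrame.base.isEndMove_cross_any (S := SC) WordVersion.v2 (castQ q) (castQ (bC j')) i c 1 hup hbq hq' hb1 hb2 hb3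
    rw [eB, Int.cast_one, one_smul] at h; exact h
  · obtain ⟨hup0, hup1, hbq, hq', hb1, hb2, hb3⟩ := (h7 rfl : K7 _ _ _ _ _)
    refine isEndPair_gen_v hqS hbS hbdeg (RatFrame.base.reflect c₀).Φ ((-1 : ℝ) • (RatFrame.base.reflect c₀).Φ (slotSite i))
      (adm_depth1_or hk hN c₀ hup0) ?_
    have h := (RatFrame.base.reflect c₀).isEndMove_cross_any (S := SC) WordVersion.v2 (castQ q) (castQ (bC j')) i c (-1) hup1 hbq hq' hb1 hb2 hb3
    simpa using h


open scoped Classical in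
/-- Version-generic row domination (copy of `sum_le_of_localEndRow'` with the word version as a parameter). -/
theorem sum_le_of_localEndRow_v {ver : WordVersion} {S : Finset (Fin 3 → ℤ)}
    (hsep : ∀ u ∈ S, ∀ v ∈ S, u ≠ v → 18 ≤ dz (u - v) (u - v))
    {sF : ℝ} (hrow : LocalEndRow ver sF S1 S2) (uz : Fin 3 → ℤ) (hz : uz ∈ S) (hzdeg : degS S uz ≤ 11)
    {ι : Type*} (B : Finset ι) (pt : ι → (Fin 3 → ℤ)) (hinj : Set.InjOn pt B) (m : ι → ℕ)
    (hnear : ∀ j ∈ B, dz (uz - pt j) (uz - pt j) ≤ 18)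
    (hm : ∀ j ∈ B, m j ≤ endMult (Xof S) ver S1 S2 (P (pt j)))
    (hmpos : ∀ j ∈ B, 0 < m j) (hpool : ∀ j ∈ B, 0 < pooledS S (pt j)) :
    ∑ j ∈ B, (m j : ℝ) / (pooledS S (pt j) : ℝ) ≤ sF := by
  have hX := sep_Xof hsep
  have hzpay : ((Xof S).filter fun q => dist (P uz) q = 1).card ≤ 11 := by rw [card_contacts]; exact hzdeg
  have h := hrow (Xof S) hX (P uz) (mem_Xof.2 hz) hzpay
  refine le_trans ?_ h
  have hinj' : Set.InjOn (fun j => P (pt j)) B := fun j hj j' hj' e => hinj hj hj' (P_injective e)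
  have hsub : B.image (fun j => P (pt j)) ⊆
      (Xof S).filter (fun b => dist (P uz) b ≤ 1 ∧ 0 < endMult (Xof S) ver S1 S2 b) := by
    intro x hx
    rw [Finset.mem_image] at hx
    obtain ⟨j, hj, rfl⟩ := hx
    rw [Finset.mem_filter]
    have hpos : 0 < endMult (Xof S) ver S1 S2 (P (pt j)) := lt_of_lt_of_le (hmpos j hj) (hm j hj)
    have hbX : P (pt j) ∈ Xof S := by
      have hpos' := hpos
      unfold endMult at hpos'
      obtain ⟨q, hq⟩ := Finset.card_pos.1 hpos'
      rw [Finset.mem_filter] at hq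
      exact hq.2.2.1
    exact ⟨hbX, (dist_P_le_one_iff uz (pt j)).2 (hnear j hj), hpos⟩
  calc ∑ j ∈ B, (m j : ℝ) / (pooledS S (pt j) : ℝ)
      ≤ ∑ j ∈ B, (endMult (Xof S) ver S1 S2 (P (pt j)) : ℝ) / pooledDef (Xof S) (P (pt j)) := by
        apply Finset.sum_le_sum
        intro j hj
        rw [pooledDef_eq]
        exact div_le_div_of_nonneg_right (by exact_mod_cast hm j hj) (by exact_mod_cast (hpool j hj).le)
    _ = ∑ x ∈ B.image (fun j => P (pt j)), (endMult (Xof S) ver S1 S2 x : ℝ) / pooledDef (Xof S) x := by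
        rw [Finset.sum_image hinj']
    _ ≤ _ := by
        apply Finset.sum_le_sum_of_subset_of_nonneg hsub
        intro x _ _
        exact div_nonneg (Nat.cast_nonneg _) (pooledDef_nonneg _ _)

end CertV2a

end EndRowFloor

set_option maxRecDepth 8192 in
open EndRowFloor EndRowFloor.CertV2a in
/-- **`EndRowTrans WordVersion.v2 s_F` forces `s_F ≥ 439/90 = 4.8778`.** -/
theorem endRowTrans_v2_ge {sF : ℝ} (h : EndRowTrans WordVersion.v2 sF) : (439 : ℝ) / 90 ≤ sF := by
  have hF := factsC
  have hsep := hF.1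
  have hz := hF.2.1
  have hzdeg := hF.2.2.1
  have hinj := hF.2.2.2.1
  have hballs := hF.2.2.2.2.1
  have hkey := hF.2.2.2.2.2.2
  have hrow : LocalEndRow WordVersion.v2 sF S1 S2 := h L
  have hsum := sum_le_of_localEndRow_v hsep hrow zC hz hzdeg (Finset.univ : Finset (Fin 8)) bC
    (fun j _ j' _ e => hinj j j' e) (fun j => (QsC j).card)
    (fun j _ => (hballs j).2.2.1) (fun j _ => card_QsC_le_endMult j) (fun j _ => (hballs j).2.2.2.2)
    (fun j _ => (hballs j).2.2.2.1)
  have hcast : ∑ j : Fin 8, (((QsC j).card : ℕ) : ℝ) / (pooledS SC (bC j) : ℝ) =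
      ((∑ j : Fin 8, ((QsC j).card : ℚ) / (pooledS SC (bC j) : ℚ) : ℚ) : ℝ) := by
    push_cast; rfl
  rw [hcast, hkey] at hsum
  have : (((439 : ℚ) / 90 : ℚ) : ℝ) = (439 : ℝ) / 90 := by push_cast; rfl
  linarith [this]

end Summit.Ventures.Crystal3D.Theorems

end
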